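import Literature.AlgebraicGeometry.HodgeTheory.KugaSatakeClassBetti
import Literature.AlgebraicGeometry.Hyperkaehler.KummerTypeHodgeSimilitudes
import HarnessLib

/-!
# "The Kuga–Satake correspondence of a projective hyperkähler variety is algebraic" — the property, on the REAL carriers, in dimension `2n` (Floccari 2024 §5; van Geemen 2000 §10; Varesco 2023 §4) — DEFINITIONS ONLY

Layer `Literature/AlgebraicGeometry/Hyperkaehler`; nothing is asserted.  Typed for the cross-ladder
literature-typing layer (D-0088(4), tranche LT-H4, seat `hodge-lit-oqh-2`) so that the OPEN QUESTION
named by Floccari 2024 §5 and O'Grady 2021 §1.1 — the Kuga–Satake Hodge conjecture for projective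
hyperkähler varieties of dimension `2n ≥ 4` — can be typed on the summit side
(`Summits/HodgeConjecture/HodgeConjecture/Theorems/OpenQuestionsFloccari.lean`, conjecture leaf
`KSH_Hyperkaehler`) in the vocabulary the tree ALREADY uses for surfaces: this file is the dimension-`2n`
twin of `HodgeTheory.IsKSCorrespondenceAlgebraicBetti` (file `HodgeTheory/KugaSatakeClassBetti`, surfaces,
intersection form `cupPairingBetti`), with the intersection form replaced by the Beauville–Bogomolov form
— pinned orientation- and marking-free, up to a scalar, by Fujiki's relation (`Hyperkaehler.IsFujikiForm`,
file `Hyperkaehler/KummerTypeHodgeSimilitudes`).  Every other clause (Kuga–Satake varieties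
`IsKugaSatakeVarietyBetti`, van Geemen's choices `e₁, e₂, κ_C`, the class map `kugaSatakeClassMapBetti`,
"induced by an algebraic cycle" = `IsAlgebraicCorrespondence`) is REUSED BY NAME from the surface file.

## Sources (read at source; locators = files of the materialised arXiv texts)

* [Flo24] S. Floccari, *Sixfolds of generalized Kummer type and K3 surfaces*, Compos. Math. 160 (2024)
  388–410 (arXiv:2210.02948) [`Floccari2024`; REFEREED], §5.1 [corpus:paper-arxiv-2210.02948
  p0016:L54–L61], verbatim: "Let `X` be a projective hyper-Kähler variety of dimension `2n`. The
  Kuga-Satake variety `KS(X)` of `X` is the abelian variety obtained from `(H²_tr(X), q_X)` via the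
  Kuga-Satake construction, where `q_X` is the restriction of the Beauville-Bogomolov form. Identifying
  `H¹(KS(X))` with its dual, there exists an embedding of Hodge structures of `H²_tr(X)` into
  `H²(KS(X) × KS(X))`. According to the Hodge conjecture this embedding should be induced by an
  algebraic cycle.  **Conjecture** (Kuga-Satake Hodge conjecture). Let `X` be a projective hyper-Kähler
  variety. There exists an algebraic cycle `ζ` on `X × KS(X) × KS(X)` such that the associated
  correspondence induces an embedding of Hodge structures `ζ_* : H²_tr(X) ↪ H²(KS(X) × KS(X))`."
  (Remark before it, L51–L52: "Replacing the form `q` with a non-zero rational multiple results in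
  isogenous Kuga-Satake varieties"; Remark after it, L63–L66: for a K3 surface "equivalent to
  [van Geemen]".)
* [OG21] K. G. O'Grady, *Compact tori associated to hyperkähler manifolds of Kummer type*, IMRN 2021
  (arXiv:1805.12075) [`OGrady2021KummerTori`; REFEREED], §1.1 [corpus:paper-arxiv-1805.12075 p0002:L18]:
  "if `X` is projective, the Hodge conjecture predicts the existence of a Kuga-Satake algebraic cycle on
  `X × KS(X,L) × KS(X,L)` realizing the homomorphism of H.S.'s in (1.1)" (`H²(X)_pr ⊂ H¹(KS) ⊗ H¹(KS)`).
* [Var23] M. Varesco, Math. Z. 305 (2023) (arXiv:2304.02519) [`Varesco2023`; REFEREED], §4 Rem. 4.3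
  [corpus:paper-arxiv-2304.02519 p0015:L22]: "neither of these two operations [changing `v₀`; changing
  `f₁, f₂`] affects the algebraicity of `κ_X`. Hence, [the Kuga–Satake Hodge conjecture] does not depend
  on the choices made in the definition of `κ_X`."
* B. van Geemen 2000 §§5–10 and D. Huybrechts, K3 book Ch. 4 §2 — as read and quoted in
  `HodgeTheory/KugaSatakeClassBetti` and `Motives/KugaSatakeHodgeConjecture` (keys
  `vanGeemen2000KugaSatakeHC`, `Huybrechts2016K3`); Beauville 1983 Thm. 5 / Huybrechts 1999 §1.9–1.11 for
  the Beauville–Bogomolov form and Fujiki's relation (as in `IsFujikiForm`).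

## What is quantified (clause by clause = `IsKSCorrespondenceAlgebraicBetti`, with the changes marked ★)

For `X` smooth projective of dimension `2n` (`hX : IsSmoothProjective (2 * n) X`):
1. ★ a Fujiki form `b` on `H²(X(ℂ); ℂ)` (`IsFujikiForm n X b`: classically `b = λ · (q_X ⊗ ℂ)`,
   `λ ∈ ℂˣ`, module docstring of `KummerTypeHodgeSimilitudes`); every notion below is insensitive to
   `λ` except clause 3(c), which PINS `λ` (see there);
2. a Hodge-symmetric Hodge model `M` of `X` and the weight-two `ℚ`-Hodge structure `H²_B(X)` it puts on
   `H²(X(ℂ); ℚ)` (`bettiTwoHodgeStructureOfModel`, the `2n`-dimensional spelling of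
   `bettiTwoHodgeStructure`);
3. ★ a presentation `(T, H, P, j)` of the TRANSCENDENTAL PART of `(H²(X, ℚ), q_X)`
   (`IsTranscendentalPartHK`): `j : T → H²(X(ℂ); ℚ)` an injective morphism of Hodge structures whose
   image is (a) exactly the set of rational classes `b`-orthogonal to all Hodge classes
   `Hdg¹ ⊂ H²(X(ℂ); ℚ)` (`= NS(X)_ℚ` by Lefschetz `(1,1)`; so `j(T) = NS(X)_ℚ^{⊥_q} = H²_tr(X, ℚ)`,
   [Flo24] "`(H²_tr(X), q_X)`"), and (c) `P(t, t') ⊗ 1 = b(j t ⊗ 1, j t' ⊗ 1)` — the polarization of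
   `T` IS the restriction of `b`; since `P` is `ℚ`-valued and a polarization, this forces `b` to be THE
   rational multiple `± q_X ⊗ ℂ` of the right sign (tree convention `i^{p-q} Q(x, x̄) > 0`, i.e.
   `b = -q_X ⊗ ℂ` on `H²_tr`: negative on `(σ, σ̄)`, positive definite on real `(1,1)`-classes of `T`),
   so NO sign binder `ε` is needed here (the surface file needs one only because its form is the fixed
   `cupPairingBetti`).  Non-vacuity (classically): `b := -(q_X ⊗ ℂ)`, `T := H²_tr(X, ℚ)`, `j` the
   inclusion, `P := b|_T` IS a presentation for every projective irreducible symplectic `X`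
   (Beauville 1983 Thm. 5: `q_X` has signature `(3, b₂ - 3)`, is positive on `(σ + σ̄)`-directions and of
   signature `(2, ρ' )`-type on `T`); with `hT : h^{2,0}(T) = 1`;
4. van Geemen's choices `e₁, e₂ ∈ T` (`P(eᵢ, eᵢ) < 0`, orthogonal) and `κ_C` (`KugaSatake.IsTensorEmbedding`
   for the trace form of `e₁e₂` and `e₁`) — VERBATIM the binders of the surface predicate;
5. a Kuga–Satake variety `(A, B, θ)` of `(T, H, P)` (`IsKugaSatakeVarietyBetti`) — verbatim;
6. conclusion — verbatim up to ★ the dimension: a `ℂ`-linear `O : H²(X(ℂ); ℂ) → H²((A × A)(ℂ); ℂ)`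
   INDUCED BY AN ALGEBRAIC CYCLE on `(A × A) × X` (`IsAlgebraicCorrespondence (dim A + dim A) (2 * n)
   (A × A) X O`; [Flo24] "an algebraic cycle `ζ` on `X × KS(X) × KS(X)`") whose restriction along `j` is
   the complexified Kuga–Satake class map `kugaSatakeClassMapBetti θ κ_C` ([Flo24] "`ζ_*` induces [the]
   embedding `H²_tr(X) ↪ H²(KS(X) × KS(X))`").
The choices in 1, 3, 4, 5 are classically immaterial ([Flo24] Remark before the Conjecture; [Var23]
Rem. 4.3; Huybrechts Rem. 4.2.7) — hence universally quantified, exactly as in the surface file.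

For `n = 1` and `X` a K3 surface the predicate is classically equivalent to
`IsKSCorrespondenceAlgebraicBetti` (`q_X` = the intersection form; [Flo24] Remark after the Conjecture:
"For a K3 surface `X`, the above form of the conjecture is equivalent to [van Geemen]") — NOT proved here
(different pinning of the form), whence a separate definition rather than a generalisation in place.

## Deliberately NOT here

Any assertion (for which `X` the property holds is the business of the summit-side conjecture leaf and
of theorems citing it: Voisin 2022 Thm. 4.1 proves it for `Kumⁿ`-type — recorded in the tree in the
`J³(X)`-form `Hyperkaehler.OGradyVoisin2022_thirdJacobian_kugaSatake_kummerType`, not in this form;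
[Var23] §5: "The Kuga–Satake Hodge conjecture has not been proven for hyperkähler manifolds of
`K3^[n]`-type"); the `H²_prim`-form of [OG21] (isogenous Kuga–Satake varieties, [Flo24] Remark); existence
of Kuga–Satake varieties on these carriers (see `Surfaces/K3PowersHodgeIffKugaSatakePowers`,
`exists_isKugaSatakeVarietyBetti`); the equivalence with the surface predicate at `n = 1`.
-/

noncomputable section

open CategoryTheory MonoidalCategory
open scoped TensorProduct
open Literature.AlgebraicTopology.SingularHomology

namespace Literature.AlgebraicGeometry.Hyperkaehler

open HodgeTheory
open Motives (SchemeOver IsSmoothProjective AbelianVariety bettiCohomology HodgeStructure)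

section TranscendentalPart

variable {n : ℕ} {X : SchemeOver ℂ} (hX : IsSmoothProjective (2 * n) X)

/-- The weight-two `ℚ`-Hodge structure `H²_B(X)` on `H²(X(ℂ); ℚ)` of a Hodge-symmetric Hodge model `M`
of the `2n`-dimensional `X`, with its weight `((2 * 1 : ℕ) : ℤ)` transported to the literal `2` — the
`2n`-dimensional spelling of `HodgeTheory.bettiTwoHodgeStructure`. [cite: VoisinHodgeI2002, §7.1.1] -/
abbrev bettiTwoHodgeStructureOfModel (M : HodgeModel (2 * n) X) (hM : M.IsHodgeSymmetric) :
    HodgeStructure (bettiCohomology X (2 * 1)) 2 :=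
  (M.hodgeStructure hX hM (2 * 1)).cast (by norm_num)

/-- **`(T, H, P)` with `j : T → H²(X(ℂ); ℚ)` presents the transcendental part `(H²_tr(X, ℚ), q_X)` of the
`2n`-dimensional `X` relative to the Fujiki form `b`** ([Flo24] §5.1 "`(H²_tr(X), q_X)` … `q_X` the
restriction of the Beauville-Bogomolov form"): `j` is an injective morphism of `ℚ`-Hodge structures
into `H²_B(X)` whose image is EXACTLY the set of classes `b`-orthogonal to every Hodge class of
`Hdg¹ ⊂ H²(X(ℂ); ℚ)` (`= NS(X)_ℚ^⊥`), and the polarization `P` of `T` is the restriction of `b`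
(`P(t,t') ⊗ 1 = b(j t ⊗ 1, j t' ⊗ 1)`; this pins the free scalar of `b`, module docstring — no sign
binder).  The `2n`-dimensional twin of `HodgeTheory.IsTranscendentalPartBetti`.
[cite: Floccari2024, §5.1 (the Kuga–Satake variety of a projective hyper-Kähler variety)]
[cite: vanGeemen2000KugaSatakeHC, §10.1–10.2] -/
def IsTranscendentalPartHK (M : HodgeModel (2 * n) X) (hM : M.IsHodgeSymmetric)
    (b : complexBetti X 2 →ₗ[ℂ] complexBetti X 2 →ₗ[ℂ] ℂ)
    {T : Type} [AddCommGroup T] [Module ℚ T] (H : HodgeStructure T 2) (P : H.Polarization)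
    (j : H.Hom (bettiTwoHodgeStructureOfModel hX M hM)) : Prop :=
  Function.Injective j.toLinearMap ∧
    (∀ x : bettiCohomology X (2 * 1), x ∈ LinearMap.range j.toLinearMap ↔
      ∀ h ∈ (M.hodgeStructure hX hM (2 * 1)).hodgeClasses 1,
        b (ofRatClass (Motives.ComplexPoints X) (2 * 1) x) (ofRatClass (Motives.ComplexPoints X) (2 * 1) h) = 0) ∧
    ∀ t t' : T, ((P.form t t' : ℚ) : ℂ) =
      b (ofRatClass (Motives.ComplexPoints X) (2 * 1) (j.toLinearMap t))
        (ofRatClass (Motives.ComplexPoints X) (2 * 1) (j.toLinearMap t'))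

/-- Unfolding lemma. [cite: Floccari2024, §5.1] -/
theorem isTranscendentalPartHK_iff (M : HodgeModel (2 * n) X) (hM : M.IsHodgeSymmetric)
    (b : complexBetti X 2 →ₗ[ℂ] complexBetti X 2 →ₗ[ℂ] ℂ)
    {T : Type} [AddCommGroup T] [Module ℚ T] (H : HodgeStructure T 2) (P : H.Polarization)
    (j : H.Hom (bettiTwoHodgeStructureOfModel hX M hM)) :
    IsTranscendentalPartHK hX M hM b H P j ↔
      Function.Injective j.toLinearMap ∧
        (∀ x : bettiCohomology X (2 * 1), x ∈ LinearMap.range j.toLinearMap ↔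
          ∀ h ∈ (M.hodgeStructure hX hM (2 * 1)).hodgeClasses 1,
            b (ofRatClass (Motives.ComplexPoints X) (2 * 1) x)
              (ofRatClass (Motives.ComplexPoints X) (2 * 1) h) = 0) ∧
        ∀ t t' : T, ((P.form t t' : ℚ) : ℂ) =
          b (ofRatClass (Motives.ComplexPoints X) (2 * 1) (j.toLinearMap t))
            (ofRatClass (Motives.ComplexPoints X) (2 * 1) (j.toLinearMap t')) :=
  Iff.rfl

/-- The image of a presentation is `b`-orthogonal to the Hodge classes (`H²_tr ⊥ NS`). [cite: Floccari2024, §5.1] -/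
theorem IsTranscendentalPartHK.apply_orthogonal {M : HodgeModel (2 * n) X} {hM : M.IsHodgeSymmetric}
    {b : complexBetti X 2 →ₗ[ℂ] complexBetti X 2 →ₗ[ℂ] ℂ}
    {T : Type} [AddCommGroup T] [Module ℚ T] {H : HodgeStructure T 2} {P : H.Polarization}
    {j : H.Hom (bettiTwoHodgeStructureOfModel hX M hM)} (h : IsTranscendentalPartHK hX M hM b H P j)
    (t : T) {c : bettiCohomology X (2 * 1)} (hc : c ∈ (M.hodgeStructure hX hM (2 * 1)).hodgeClasses 1) :
    b (ofRatClass (Motives.ComplexPoints X) (2 * 1) (j.toLinearMap t))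
      (ofRatClass (Motives.ComplexPoints X) (2 * 1) c) = 0 :=
  (h.2.1 (j.toLinearMap t)).1 (LinearMap.mem_range_self _ t) c hc

end TranscendentalPart

/-! ### "The Kuga–Satake correspondence of `X` is algebraic", dimension `2n` -/

section Correspondence

/-- **The Kuga–Satake correspondence of the `2n`-dimensional `X` is algebraic** — the PROPERTY of the
smooth projective `X` (intended: projective hyperkähler of dimension `2n`; asserted for no `X` here), in
the transcendental-lattice form printed by Floccari 2024 §5.1 ("There exists an algebraic cycle `ζ` on
`X × KS(X) × KS(X)` such that the associated correspondence induces an embedding of Hodge structures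
`ζ_* : H²_tr(X) ↪ H²(KS(X) × KS(X))`", `KS(X)` built from `(H²_tr(X), q_X)`), ON THE REAL CARRIERS and
clause by clause as `HodgeTheory.IsKSCorrespondenceAlgebraicBetti` (module docstring, items 1–6):
FOR ALL Fujiki forms `b` (`IsFujikiForm n X b`, the Beauville–Bogomolov form up to the scalar that
clause 3 pins), Hodge-symmetric Hodge models `M`, presentations `(T, H, P, j)` of `(H²_tr(X, ℚ), q_X)`
with `h^{2,0} = 1` (`IsTranscendentalPartHK`), orthogonal `e₁, e₂` with `P(eᵢ,eᵢ) < 0`, tensor embeddings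
`κ_C` (`KugaSatake.IsTensorEmbedding`) and Kuga–Satake varieties `(A, B, θ)` (`IsKugaSatakeVarietyBetti`),
THERE IS a `ℂ`-linear `O : H²(X(ℂ); ℂ) → H²((A × A)(ℂ); ℂ)` induced by an algebraic cycle on `(A × A) × X`
(`IsAlgebraicCorrespondence (dim A + dim A) (2 * n) (A × A) X O`) restricting along `j` to the
complexified Kuga–Satake class map.  For `Kumⁿ`-type this is a THEOREM in print (Voisin 2022 Thm. 4.1,
recorded in the tree in `J³(X)`-form only); for `K3^[n]`-type "has not been proven" (Varesco 2023 §5).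
A predicate with `X` as argument, asserted for no `X` (the summit side states for which `X` it is
expected). [cite: Floccari2024, §5.1 (the Kuga–Satake statement for projective hyper-Kähler varieties and the two Remarks around it)]
[cite: OGrady2021KummerTori, §1.1 (arXiv p. 2: "predicts the existence of a Kuga-Satake algebraic cycle on X × KS(X,L) × KS(X,L)")]
[cite: Varesco2023, §4 Rem. 4.3] [cite: vanGeemen2000KugaSatakeHC, §10.2–10.3] -/
def IsKSCorrespondenceAlgebraicHK (n : ℕ) {X : SchemeOver ℂ} (hX : IsSmoothProjective (2 * n) X) : Prop :=
  ∀ (b : complexBetti X 2 →ₗ[ℂ] complexBetti X 2 →ₗ[ℂ] ℂ), IsFujikiForm n X b →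
  ∀ (M : HodgeModel (2 * n) X) (hM : M.IsHodgeSymmetric)
    (T : Type) [AddCommGroup T] [Module ℚ T] (H : HodgeStructure T 2) (P : H.Polarization)
    (hT : H.hodgeNumber 2 0 = 1) (j : H.Hom (bettiTwoHodgeStructureOfModel hX M hM)),
    IsTranscendentalPartHK hX M hM b H P j →
  ∀ (e₁ e₂ : T), P.form e₁ e₂ = 0 → P.form e₁ e₁ < 0 → P.form e₂ e₂ < 0 →
  ∀ (κC : T →ₗ[ℚ] CliffordAlgebra.even P.quadraticForm ⊗[ℚ] CliffordAlgebra.even P.quadraticForm),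
    Motives.HodgeStructure.KugaSatake.IsTensorEmbedding P.quadraticForm
      (Motives.HodgeStructure.KugaSatake.traceForm P.quadraticForm
        ((CliffordAlgebra.even.ι P.quadraticForm).bilin e₁ e₂)) e₁ κC →
  ∀ (A : AbelianVariety ℂ) (B : HodgeModel A.dim A.X) (hB : B.IsHodgeSymmetric)
    (θ : bettiCohomology A.X 1 ≃ₗ[ℚ] CliffordAlgebra.even P.quadraticForm),
    IsKugaSatakeVarietyBetti H P hT A B hB θ →
  ∃ O : complexBetti X (2 * 1) →ₗ[ℂ] complexBetti (A.X ⊗ A.X) 2,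
    IsAlgebraicCorrespondence (A.dim + A.dim) (2 * n) (A.X ⊗ A.X) X O ∧
      ∀ t : T, O (ofRatClass (Motives.ComplexPoints X) (2 * 1) (j.toLinearMap t)) =
        ofRatClass (Motives.ComplexPoints (A.X ⊗ A.X)) 2 (kugaSatakeClassMapBetti H P θ κC t)

end Correspondence

end Literature.AlgebraicGeometry.Hyperkaehler

end
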